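import Summits.QuantumFields.YangMills.Theorems.FluctuationComparisonRegPrIntLS2BetaCoarseCurlOfChartRead
import Summits.QuantumFields.YangMills.Theorems.FluctuationComparisonRegPrIntLS2BetaChartReadGlobalSizes
import HarnessLib

/-!
# S2β · (CURL-AVG, FILE D) JUNCTION LETTERS: THE PLAQUETTE WORD IS `plaqHol`; «RELATIVE PLAQUETTE VS LINEARISED CURL» AT ANY LEVEL —
# `‖↑(U′(∂p)·V(∂p)⁻¹) − 1 − Y_V(∂p)[Ẑ]‖ ≤ e^S − 1 − S` for `U′ = Θ(Z)·V`, `S = Σ_k ‖Z(c_k)‖`; fine (`V = U₀, Z = X`) and coarse (`V = Ū(U₀), Z = ψ_{U₀}(X)`) specialisations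

Cell `ym3-torus` (YM ladder rung R3 = continuum `SU(2)` Yang–Mills on the three-torus at fixed lattice data — a RUNG: NOT d = 4, NOT infinite volume, NOT a mass gap,
NOT Clay).  Width seat `ym3-torus-px13` (gen 26); crux `stmt-QuantumFields-20520`, LINE g18-1 S2β, pairing lane, AVG₂♭-ax_q ∕ `hLoc` ⟸ SUP chain ⟸ (ST) ⟸ LIFT-LADDER
(px17 g22 ✓`…SupTowerOfLiftLadder`: (TOP-LAD) ∧ (LIFT-LAD) ∧ (SCT-c)); the (CURL-AVG) chain A ✓p829604 → B1 ✓p830057 → B2 ✓p830155 → C ✓p830200 states the per-step transport of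
LINEARISED curls `Y_V(∂p)[Z] = covWalkSum V Z (walk y [μ⁺,ν⁺,μ̄,ν̄])`.  THIS FILE is the currency junction to GROUP-valued relative plaquettes (the objects of `REL` and of `PlaqSmall`):
the plaquette word's holonomy IS `GaugeField.plaqHol` (§1), and for a perturbed configuration `U′(c) = Θ(Z(c))·V(c)` the relative plaquette `U′(∂p)·V(∂p)⁻¹` equals
`1 + Y_V(∂p)[Ẑ]` up to the universal second-order remainder `e^S − 1 − S ≤ ½S²e^S`, `S` the sum of the four chart sizes on `∂p` (§2–§3); at the fine level this reads the
fine relative plaquettes of `(Θ(X)·U₀, U₀)` through `Y_{U₀}(∂q)[X̂]` (§4), at the coarse level — on the polydisc where the chart inverts — the coarse relative plaquettes of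
`(Ū(Θ(X)U₀), Ū(U₀))` through `Y_{Ū(U₀)}(∂p′)[ψ̂_{U₀}(X)]`, the left-hand side of FILE C (§4).  `--kind proof --supports stmt-QuantumFields-20520 --as helper`, count-neutral,
DEFINITION-FREE; generic `P : Params`, `SU(N)`, any level.

WHAT IS PROVED (sorry-free).
* §1 `holAt_walk_plaq_eq_plaqHol` — `holAt U (walk y [μ⁺,ν⁺,μ̄,ν̄]) = plaqHol U ⟨y, μ, ν, _⟩` (so FILE B2∕C's `hαp` reads off the coarse `PlaqSmall`: `dist1_holAt_walk_plaq_lt`).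
* §2 `norm_mul_sub_one_sub_add_le` (two-factor step), `norm_coe_conj_sub_one_sub_le` (unitary conjugation keeps the first-order defect), ★`norm_prod_four_sub_one_sub_le`
  (`‖x₁x₂x₃x₄ − 1 − (u₁+u₂+u₃+u₄)‖ ≤ e^{Σs} − 1 − Σs` from the four factor defects), `plaqHol_mul_inv_eq_prod_conj` (`(E₁V₁)(E₂V₂)(E₃V₃)⁻¹(E₄V₄)⁻¹·(V(∂p))⁻¹ =
  E₁·Ad_{V₁}E₂·Ad_{T₃}E₃⁻¹·Ad_{T₄}E₄⁻¹`, `group`).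
* §3 ★★★`norm_coe_relPlaq_sub_one_sub_curl_le` — ANY level `k`, `V`, `Z : PBond P k → 𝔰𝔲(N)`, `U′ = Θ(Z)·V`:
  **`‖↑(plaqHol U′ p · (plaqHol V p)⁻¹) − 1 − Y_V(∂p)[Ẑ]‖ ≤ e^S − 1 − S`, `S = ‖Z c₁‖ + ‖Z c₂‖ + ‖Z c₃‖ + ‖Z c₄‖`** (`e^S − 1 − S ≤ S²` for `S ≤ 1`: tree ✓`B13ReadingsLineProducts.exp_sub_one_sub_le_sq`).
* §4 ★★`norm_coe_relPlaq_fine_sub_one_sub_curl_le` (fine level: `V = U₀`, `Z = X`, `S ≤ 4‖X‖`); ★★★`norm_coe_relPlaq_avgFun_sub_one_sub_curl_le` (coarse level: on the polydisc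
  `100ℓ(e^{‖X‖} − 1) ≤ ρ ≤ innerRadius`, `4α ≤ ρ`, loop guard at every coarse bond, the chart inverts by ✓`expChart_logChart` + (β-2) ✓`norm_coe_relAvg_sub_one_le`, and
  **`‖↑(plaqHol (Ū(Θ(X)U₀)) p′ · (plaqHol (Ū U₀) p′)⁻¹) − 1 − Y_{Ū(U₀)}(∂p′)[ψ̂_{U₀}(X)]‖ ≤ e^S − 1 − S`, `S = Σ_k ‖ψ_{U₀}(X)(c_k)‖ ≤ 4·(560∕ρ)·ℓ·‖X‖`** by (β-5) ✓`norm_coe_chartRead_le_global`).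

WHY (px17 g22 FILE 3, px16 g22 17:30:20Z ∕ 17:41:19Z).  (SCT-c)'s `c_t` may be priced in plaquette (group ∕ `REL`) currency or in linearised-curl currency; §3–§4 make the two
interchangeable at second order, so FILE C's row «coarse curl ≤ diluted fine curls + O(θ)M + O(M²)» holds verbatim for `dist1` of relative plaquettes (add `e^S − 1 − S` on each side).

HONEST.  Matrix ∕ group bookkeeping over landed letters (lit `B7TransferAnalyticMean.norm_exp_sub_one_sub_self_le`, ✓`coe_expChart`, ✓`expChart_logChart`, (β-2) ✓p828117, (β-5)
✓p828575, B1 ✓p830057); nothing of Bałaban's analysis asserted; (SCT-c)∕(SCT), (ST), LOC ∕ `hLoc`, AVG₂♭-ax_q, GAP♯∘ (registry 3732b7df UNTOUCHED, 0∕5), the five REGISTERED stubs, S2β,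
crux 20520, 19936, 19200, `YM3TorusSU2` — NOT proved; rung R3 = SU(2) YM₃ on T³ at fixed lattice data — NOT d = 4, NOT infinite volume, NOT a mass gap, NOT Clay; the Yang–Mills
mass gap is NOT proved.  Axioms standard.

References: [Balaban1985Averaging] CMP **98** (1985) (9)–(10) p.19, (19)–(20) p.21, (58) p.27; [Balaban1987RG1] CMP **109** (1987) (0.4), (0.8), (0.18) pp.253–255.
-/

set_option autoImplicit false

noncomputable section

open scoped Matrix.Norms.L2Operator BigOperators
open Finset

namespace Summit.QuantumFields.YangMills.Theorems.FluctuationComparisonRegPrIntLS2BetaCoarseCurlJunction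

open Literature.MathematicalPhysics.QuantumFieldTheory.Balaban1983to89
open Literature.MathematicalPhysics.QuantumFieldTheory.Balaban1983to89.T4Continuum
open Literature.MathematicalPhysics.QuantumFieldTheory.Balaban1983to89.HaarExponentialChart
open Literature.MathematicalPhysics.QuantumFieldTheory.Balaban1983to89.HaarExponentialChart.IsChartRep
open Literature.MathematicalPhysics.QuantumFieldTheory.Balaban1983to89.BlockAveraging (Idx avgFun loopHol off corr Small)
open Literature.MathematicalPhysics.QuantumFieldTheory.Balaban1983to89.ExpMeanLog (expMeanLogSU deltaSU)
open Literature.MathematicalPhysics.QuantumFieldTheory.Balaban1983to89.BlockAveragingEMLLinearised (stepFactor length_walk)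
open Literature.MathematicalPhysics.QuantumFieldTheory.Balaban1983to89.BlockAveragingEMLLinearisedBackground
  (covStep covWalkSum covWalkSum_nil covWalkSum_cons covWalkSum_append covWalkSum_add covLinAvgR0 norm_covWalkSum_le)
open Literature.MathematicalPhysics.QuantumFieldTheory.Balaban1983to89.B10StarCount (shift_unshift unshift_shift)
open Literature.MathematicalPhysics.QuantumFieldTheory.Balaban1983to89.BlockAveragingEMLProp2 (shift_shift_comm)
open Literature.MathematicalPhysics.QuantumFieldTheory.Balaban1983to89.Node00
open Literature.MathematicalPhysics.QuantumLattice (fundamentalRep fundamentalRep_apply)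
open Summit.QuantumFields.YangMills.BalabanUVNodes.N09ChartReadAveragingSmooth (coe_expChart)
open Summit.QuantumFields.YangMills.Theorems.FluctuationComparisonRegPrIntLS2BetaChartReadCplxAnalytic (norm_coePi_le norm_coe_relAvg_sub_one_le)
open Summit.QuantumFields.YangMills.Theorems.FluctuationComparisonRegPrIntLS2BetaChartReadGlobalSizes (norm_coe_chartRead_le_global)
open Summit.QuantumFields.YangMills.Theorems.FluctuationComparisonRegPrIntLS2BetaCovWalkSumStokes (norm_coe_conj_le)
open Summit.QuantumFields.YangMills.Theorems.FluctuationComparisonRegPrIntLS2BetaCoarseCurlTransports (covWalkSum_walk_plaq_eq shift_shift_unshift)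

variable {P : Params} {j : ℕ} {N : ℕ} [NeZero N]

/-! ## §1 The plaquette word's holonomy is `plaqHol` -/

section PlaqWord

variable {G : Type*} [GaugeGroup G]

/-- The holonomy of the plaquette word `[μ⁺, ν⁺, μ̄, ν̄]` from `y` IS the plaquette variable `U(∂p)` of `p = (y; μ, ν)` (tree `GaugeField.plaqHol`). [cite: Balaban1985Averaging, (9) p.19] -/
theorem holAt_walk_plaq_eq_plaqHol {k : ℕ} (U : GaugeField P k G) (y : Site P k) {μ ν : Fin P.d} (hμν : μ < ν) :
    holAt U (walk y [((μ, true) : Letter P.d), (ν, true), (μ, false), (ν, false)]) = GaugeField.plaqHol U ⟨y, μ, ν, hμν⟩ := by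
  simp only [walk, holAt_cons, holAt_nil, GaugeField.plaqHol, shift_shift_unshift, unshift_shift, Bool.false_eq_true, ↓reduceIte, mul_one, mul_assoc]

/-- Hence under `PlaqSmall δ′ V` at the coarse level, `dist1 V(walk y [μ⁺,ν⁺,μ̄,ν̄]) < δ′` — FILE B2∕C's hypothesis `hαp` discharged by the coarse small-field condition.
[cite: Balaban1987RG1, (0.18) p.255] -/
theorem dist1_holAt_walk_plaq_lt {k : ℕ} {U : GaugeField P k G} {δ' : ℝ} (hU : PlaqSmall δ' U) (y : Site P k) {μ ν : Fin P.d} (hμν : μ < ν) :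
    dist1 (holAt U (walk y [((μ, true) : Letter P.d), (ν, true), (μ, false), (ν, false)])) < δ' := by
  rw [holAt_walk_plaq_eq_plaqHol U y hμν]; exact hU _

end PlaqWord

/-! ## §2 First-order expansion of a four-factor product; the relative plaquette factorised along the word -/

section Product

omit [NeZero N] in
/-- Two-factor step of the first-order product expansion: `‖xy − 1 − (u + v)‖ ≤ e^{s+t} − 1 − (s+t)` from the same for `(x, u, s)` and `(y, v, t)`. [folklore] -/
theorem norm_mul_sub_one_sub_add_le {𝔸 : Type*} [NormedRing 𝔸] [NormOneClass 𝔸] {x y u v : 𝔸} {s t : ℝ}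
    (hx : ‖x - 1 - u‖ ≤ Real.exp s - 1 - s) (hu : ‖u‖ ≤ s) (hy : ‖y - 1 - v‖ ≤ Real.exp t - 1 - t) (hv : ‖v‖ ≤ t) :
    ‖x * y - 1 - (u + v)‖ ≤ Real.exp (s + t) - 1 - (s + t) := by
  have hx1 : ‖x - 1‖ ≤ Real.exp s - 1 := by
    have e : x - 1 = (x - 1 - u) + u := by abel
    rw [e]; exact (norm_add_le _ _).trans (by linarith)
  have hy1 : ‖y - 1‖ ≤ Real.exp t - 1 := by
    have e : y - 1 = (y - 1 - v) + v := by abel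
    rw [e]; exact (norm_add_le _ _).trans (by linarith)
  have hs0 : 0 ≤ Real.exp s - 1 := (norm_nonneg _).trans hx1
  have e : x * y - 1 - (u + v) = (x - 1) * (y - 1) + (x - 1 - u) + (y - 1 - v) := by noncomm_ring
  rw [e, Real.exp_add]
  calc _ ≤ ‖(x - 1) * (y - 1)‖ + ‖x - 1 - u‖ + ‖y - 1 - v‖ := (norm_add_le _ _).trans (add_le_add (norm_add_le _ _) le_rfl)
    _ ≤ (Real.exp s - 1) * (Real.exp t - 1) + (Real.exp s - 1 - s) + (Real.exp t - 1 - t) :=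
        add_le_add (add_le_add ((norm_mul_le _ _).trans (mul_le_mul hx1 hy1 (norm_nonneg _) hs0)) hx) hy
    _ = Real.exp s * Real.exp t - 1 - (s + t) := by ring

omit [NeZero N] in
/-- ★ **FIRST-ORDER EXPANSION OF A FOUR-FACTOR PRODUCT**: `‖x₁x₂x₃x₄ − 1 − (u₁+u₂+u₃+u₄)‖ ≤ e^{s₁+s₂+s₃+s₄} − 1 − (s₁+s₂+s₃+s₄)` from the factor defects `‖x_k − 1 − u_k‖ ≤ e^{s_k} − 1 − s_k`,
`‖u_k‖ ≤ s_k`. [cite: Balaban1985Averaging, (19)-(20) p.21 (bookkeeping)] -/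
theorem norm_prod_four_sub_one_sub_le {𝔸 : Type*} [NormedRing 𝔸] [NormOneClass 𝔸] {x₁ x₂ x₃ x₄ u₁ u₂ u₃ u₄ : 𝔸} {s₁ s₂ s₃ s₄ : ℝ}
    (h₁ : ‖x₁ - 1 - u₁‖ ≤ Real.exp s₁ - 1 - s₁) (hu₁ : ‖u₁‖ ≤ s₁) (h₂ : ‖x₂ - 1 - u₂‖ ≤ Real.exp s₂ - 1 - s₂) (hu₂ : ‖u₂‖ ≤ s₂)
    (h₃ : ‖x₃ - 1 - u₃‖ ≤ Real.exp s₃ - 1 - s₃) (hu₃ : ‖u₃‖ ≤ s₃) (h₄ : ‖x₄ - 1 - u₄‖ ≤ Real.exp s₄ - 1 - s₄) (hu₄ : ‖u₄‖ ≤ s₄) :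
    ‖x₁ * x₂ * x₃ * x₄ - 1 - (u₁ + u₂ + u₃ + u₄)‖ ≤ Real.exp (s₁ + s₂ + s₃ + s₄) - 1 - (s₁ + s₂ + s₃ + s₄) := by
  have h12 := norm_mul_sub_one_sub_add_le h₁ hu₁ h₂ hu₂
  have h123 := norm_mul_sub_one_sub_add_le h12 ((norm_add_le _ _).trans (add_le_add hu₁ hu₂)) h₃ hu₃
  have h1234 := norm_mul_sub_one_sub_add_le h123 ((norm_add_le _ _).trans (add_le_add ((norm_add_le _ _).trans (add_le_add hu₁ hu₂)) hu₃)) h₄ hu₄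
  simpa [add_assoc] using h1234

/-- **UNITARY CONJUGATION KEEPS THE FIRST-ORDER DEFECT**: `‖g·x·g⋆ − 1 − g·u·g⋆‖ ≤ ‖x − 1 − u‖` for `g ∈ SU(N)`. [cite: Balaban1985Averaging, (19)-(20) p.21 (bookkeeping)] -/
theorem norm_coe_conj_sub_one_sub_le (g : SU N) (x u : Matrix (Fin N) (Fin N) ℂ) :
    ‖(g : Matrix (Fin N) (Fin N) ℂ) * x * star (g : Matrix (Fin N) (Fin N) ℂ) - 1 - (g : Matrix (Fin N) (Fin N) ℂ) * u * star (g : Matrix (Fin N) (Fin N) ℂ)‖ ≤ ‖x - 1 - u‖ := by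
  have hg : (g : Matrix (Fin N) (Fin N) ℂ) * star (g : Matrix (Fin N) (Fin N) ℂ) = 1 := coe_mul_star_coe_SU g
  have e : (g : Matrix (Fin N) (Fin N) ℂ) * x * star (g : Matrix (Fin N) (Fin N) ℂ) - 1 - (g : Matrix (Fin N) (Fin N) ℂ) * u * star (g : Matrix (Fin N) (Fin N) ℂ) =
      (g : Matrix (Fin N) (Fin N) ℂ) * (x - 1 - u) * star (g : Matrix (Fin N) (Fin N) ℂ) := by
    rw [mul_sub, mul_sub, sub_mul, sub_mul, mul_one, hg]
  rw [e]; exact norm_coe_conj_le g _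

omit [NeZero N] in
/-- **THE RELATIVE PLAQUETTE FACTORISED ALONG THE WORD**: for `U′ = E·V` bondwise,
`U′(∂p)·V(∂p)⁻¹ = E₁ · (V₁E₂V₁⁻¹) · (T₃E₃⁻¹T₃⁻¹) · (T₄E₄⁻¹T₄⁻¹)`, `T₃ = V₁V₂V₃⁻¹`, `T₄ = V₁V₂V₃⁻¹V₄⁻¹` (group identity). [cite: Balaban1985Averaging, (9) p.19, (19)-(20) p.21] -/
theorem plaqHol_mul_inv_eq_prod_conj {G' : Type*} [Group G'] (E₁ E₂ E₃ E₄ V₁ V₂ V₃ V₄ : G') :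
    (E₁ * V₁) * (E₂ * V₂) * (E₃ * V₃)⁻¹ * (E₄ * V₄)⁻¹ * (V₁ * V₂ * V₃⁻¹ * V₄⁻¹)⁻¹ =
      E₁ * (V₁ * E₂ * V₁⁻¹) * ((V₁ * V₂ * V₃⁻¹) * E₃⁻¹ * (V₁ * V₂ * V₃⁻¹)⁻¹) * ((V₁ * V₂ * V₃⁻¹ * V₄⁻¹) * E₄⁻¹ * (V₁ * V₂ * V₃⁻¹ * V₄⁻¹)⁻¹) := by
  group

end Product

/-! ## §3 ★★★ Relative plaquette versus linearised curl, at any level -/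

section RelPlaq

/-- ★★★ **THE RELATIVE PLAQUETTE OF `(Θ(Z)·V, V)` IS `1 + Y_V(∂p)[Ẑ]` UP TO `e^S − 1 − S`**: for any level `k`, background `V`, chart field `Z : PBond P k → 𝔰𝔲(N)` and
`U′(c) = Θ(Z(c))·V(c)`, with `c₁ = ⟨y,μ⟩, c₂ = ⟨y+e_μ,ν⟩, c₃ = ⟨y+e_ν,μ⟩, c₄ = ⟨y,ν⟩` and `S = ‖Z c₁‖ + ‖Z c₂‖ + ‖Z c₃‖ + ‖Z c₄‖`:
`‖↑(U′(∂p)·V(∂p)⁻¹) − 1 − covWalkSum V Ẑ (walk y [μ⁺,ν⁺,μ̄,ν̄])‖ ≤ e^S − 1 − S` (`U′(∂p)V(∂p)⁻¹ = e^{Ẑ₁}·Ad_{V₁}e^{Ẑ₂}·Ad_{T₃}e^{−Ẑ₃}·Ad_{T₄}e^{−Ẑ₄}`, §2, and B1 ✓`covWalkSum_walk_plaq_eq`).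
[cite: Balaban1985Averaging, (9) p.19, (19)-(20) p.21, (58) p.27; Balaban1987RG1, (0.8) p.253] -/
theorem norm_coe_relPlaq_sub_one_sub_curl_le {k : ℕ} (V : GaugeField P k (SU N)) (Z : PBond P k → (specialUnitaryLogChart (Fin N)).lie) (y : Site P k)
    {μ ν : Fin P.d} (hμν : μ < ν) :
    ‖((GaugeField.plaqHol (fun c => (isChartRep_specialUnitaryGroup (n := Fin N)).expChart (Z c) * V c) ⟨y, μ, ν, hμν⟩ * (GaugeField.plaqHol V ⟨y, μ, ν, hμν⟩)⁻¹ : SU N) :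
          Matrix (Fin N) (Fin N) ℂ) - 1 -
        covWalkSum V (fun c => ((Z c : (specialUnitaryLogChart (Fin N)).lie) : Matrix (Fin N) (Fin N) ℂ)) (walk y [((μ, true) : Letter P.d), (ν, true), (μ, false), (ν, false)])‖ ≤
      Real.exp (‖Z ⟨y, μ⟩‖ + ‖Z ⟨y.shift μ, ν⟩‖ + ‖Z ⟨y.shift ν, μ⟩‖ + ‖Z ⟨y, ν⟩‖) - 1 - (‖Z ⟨y, μ⟩‖ + ‖Z ⟨y.shift μ, ν⟩‖ + ‖Z ⟨y.shift ν, μ⟩‖ + ‖Z ⟨y, ν⟩‖) := by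
  -- names
  set E : PBond P k → SU N := fun c => (isChartRep_specialUnitaryGroup (n := Fin N)).expChart (Z c) with hE
  set Zm : PBond P k → Matrix (Fin N) (Fin N) ℂ := fun c => ((Z c : (specialUnitaryLogChart (Fin N)).lie) : Matrix (Fin N) (Fin N) ℂ) with hZm
  set V₁ : SU N := V ⟨y, μ⟩
  set V₂ : SU N := V ⟨y.shift μ, ν⟩
  set V₃ : SU N := V ⟨y.shift ν, μ⟩
  set V₄ : SU N := V ⟨y, ν⟩
  set T₃ : SU N := V₁ * V₂ * V₃⁻¹ with hT₃
  set T₄ : SU N := V₁ * V₂ * V₃⁻¹ * V₄⁻¹ with hT₄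
  have hskew : ∀ c, star (Zm c) = -Zm c := fun c => (mem_specialUnitaryLogChart_lie.1 (Z c).2).1
  have hnZ : ∀ c, ‖Zm c‖ = ‖Z c‖ := fun c => Submodule.norm_coe (Z c)
  have hcoeE : ∀ c, ((E c : SU N) : Matrix (Fin N) (Fin N) ℂ) = NormedSpace.exp (Zm c) := fun c => coe_expChart (Z c)
  have hcoeEinv : ∀ c, (((E c)⁻¹ : SU N) : Matrix (Fin N) (Fin N) ℂ) = NormedSpace.exp (-Zm c) := fun c => by
    rw [coe_inv_SU, hcoeE, NormedSpace.star_exp, hskew]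
  -- the group identity, then coercions factor by factor
  have hP : (GaugeField.plaqHol (fun c => E c * V c) ⟨y, μ, ν, hμν⟩ * (GaugeField.plaqHol V ⟨y, μ, ν, hμν⟩)⁻¹ : SU N) =
      E ⟨y, μ⟩ * (V₁ * E ⟨y.shift μ, ν⟩ * V₁⁻¹) * (T₃ * (E ⟨y.shift ν, μ⟩)⁻¹ * T₃⁻¹) * (T₄ * (E ⟨y, ν⟩)⁻¹ * T₄⁻¹) := by
    simp only [GaugeField.plaqHol]
    exact plaqHol_mul_inv_eq_prod_conj _ _ _ _ _ _ _ _
  have hx₂ : ((V₁ * E ⟨y.shift μ, ν⟩ * V₁⁻¹ : SU N) : Matrix (Fin N) (Fin N) ℂ) = (V₁ : Matrix (Fin N) (Fin N) ℂ) * NormedSpace.exp (Zm ⟨y.shift μ, ν⟩) * star (V₁ : Matrix (Fin N) (Fin N) ℂ) := by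
    rw [Submonoid.coe_mul, Submonoid.coe_mul, coe_inv_SU, hcoeE]
  have hx₃ : ((T₃ * (E ⟨y.shift ν, μ⟩)⁻¹ * T₃⁻¹ : SU N) : Matrix (Fin N) (Fin N) ℂ) = (T₃ : Matrix (Fin N) (Fin N) ℂ) * NormedSpace.exp (-Zm ⟨y.shift ν, μ⟩) * star (T₃ : Matrix (Fin N) (Fin N) ℂ) := by
    rw [Submonoid.coe_mul, Submonoid.coe_mul, coe_inv_SU T₃, hcoeEinv]
  have hx₄ : ((T₄ * (E ⟨y, ν⟩)⁻¹ * T₄⁻¹ : SU N) : Matrix (Fin N) (Fin N) ℂ) = (T₄ : Matrix (Fin N) (Fin N) ℂ) * NormedSpace.exp (-Zm ⟨y, ν⟩) * star (T₄ : Matrix (Fin N) (Fin N) ℂ) := by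
    rw [Submonoid.coe_mul, Submonoid.coe_mul, coe_inv_SU T₄, hcoeEinv]
  rw [hP, Submonoid.coe_mul, Submonoid.coe_mul, Submonoid.coe_mul, hx₂, hx₃, hx₄, hcoeE, covWalkSum_walk_plaq_eq V Zm y μ ν]
  -- the four factor defects
  have h₁ : ‖NormedSpace.exp (Zm ⟨y, μ⟩) - 1 - Zm ⟨y, μ⟩‖ ≤ Real.exp ‖Z ⟨y, μ⟩‖ - 1 - ‖Z ⟨y, μ⟩‖ := by
    rw [← hnZ]; exact B7TransferAnalyticMean.norm_exp_sub_one_sub_self_le _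
  have h₂ : ‖(V₁ : Matrix (Fin N) (Fin N) ℂ) * NormedSpace.exp (Zm ⟨y.shift μ, ν⟩) * star (V₁ : Matrix (Fin N) (Fin N) ℂ) - 1 -
      (V₁ : Matrix (Fin N) (Fin N) ℂ) * Zm ⟨y.shift μ, ν⟩ * star (V₁ : Matrix (Fin N) (Fin N) ℂ)‖ ≤ Real.exp ‖Z ⟨y.shift μ, ν⟩‖ - 1 - ‖Z ⟨y.shift μ, ν⟩‖ := by
    rw [← hnZ]; exact (norm_coe_conj_sub_one_sub_le _ _ _).trans (B7TransferAnalyticMean.norm_exp_sub_one_sub_self_le _)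
  have h₃ : ‖(T₃ : Matrix (Fin N) (Fin N) ℂ) * NormedSpace.exp (-Zm ⟨y.shift ν, μ⟩) * star (T₃ : Matrix (Fin N) (Fin N) ℂ) - 1 -
      (T₃ : Matrix (Fin N) (Fin N) ℂ) * (-Zm ⟨y.shift ν, μ⟩) * star (T₃ : Matrix (Fin N) (Fin N) ℂ)‖ ≤ Real.exp ‖Z ⟨y.shift ν, μ⟩‖ - 1 - ‖Z ⟨y.shift ν, μ⟩‖ := by
    rw [← hnZ, ← norm_neg (Zm ⟨y.shift ν, μ⟩)]
    exact (norm_coe_conj_sub_one_sub_le _ _ _).trans (B7TransferAnalyticMean.norm_exp_sub_one_sub_self_le _)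
  have h₄ : ‖(T₄ : Matrix (Fin N) (Fin N) ℂ) * NormedSpace.exp (-Zm ⟨y, ν⟩) * star (T₄ : Matrix (Fin N) (Fin N) ℂ) - 1 -
      (T₄ : Matrix (Fin N) (Fin N) ℂ) * (-Zm ⟨y, ν⟩) * star (T₄ : Matrix (Fin N) (Fin N) ℂ)‖ ≤ Real.exp ‖Z ⟨y, ν⟩‖ - 1 - ‖Z ⟨y, ν⟩‖ := by
    rw [← hnZ, ← norm_neg (Zm ⟨y, ν⟩)]
    exact (norm_coe_conj_sub_one_sub_le _ _ _).trans (B7TransferAnalyticMean.norm_exp_sub_one_sub_self_le _)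
  have hu₁ : ‖Zm ⟨y, μ⟩‖ ≤ ‖Z ⟨y, μ⟩‖ := (hnZ _).le
  have hu₂ : ‖(V₁ : Matrix (Fin N) (Fin N) ℂ) * Zm ⟨y.shift μ, ν⟩ * star (V₁ : Matrix (Fin N) (Fin N) ℂ)‖ ≤ ‖Z ⟨y.shift μ, ν⟩‖ := (norm_coe_conj_le _ _).trans (hnZ _).le
  have hu₃ : ‖(T₃ : Matrix (Fin N) (Fin N) ℂ) * (-Zm ⟨y.shift ν, μ⟩) * star (T₃ : Matrix (Fin N) (Fin N) ℂ)‖ ≤ ‖Z ⟨y.shift ν, μ⟩‖ :=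
    (norm_coe_conj_le _ _).trans (by rw [norm_neg, hnZ])
  have hu₄ : ‖(T₄ : Matrix (Fin N) (Fin N) ℂ) * (-Zm ⟨y, ν⟩) * star (T₄ : Matrix (Fin N) (Fin N) ℂ)‖ ≤ ‖Z ⟨y, ν⟩‖ :=
    (norm_coe_conj_le _ _).trans (by rw [norm_neg, hnZ])
  have h := norm_prod_four_sub_one_sub_le h₁ hu₁ h₂ hu₂ h₃ hu₃ h₄ hu₄
  -- match the linear terms
  have e : Zm ⟨y, μ⟩ + (V₁ : Matrix (Fin N) (Fin N) ℂ) * Zm ⟨y.shift μ, ν⟩ * star (V₁ : Matrix (Fin N) (Fin N) ℂ) +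
        (T₃ : Matrix (Fin N) (Fin N) ℂ) * (-Zm ⟨y.shift ν, μ⟩) * star (T₃ : Matrix (Fin N) (Fin N) ℂ) + (T₄ : Matrix (Fin N) (Fin N) ℂ) * (-Zm ⟨y, ν⟩) * star (T₄ : Matrix (Fin N) (Fin N) ℂ) =
      Zm ⟨y, μ⟩ + ((V ⟨y, μ⟩ : SU N) : Matrix (Fin N) (Fin N) ℂ) * Zm ⟨y.shift μ, ν⟩ * star ((V ⟨y, μ⟩ : SU N) : Matrix (Fin N) (Fin N) ℂ) -
        ((V ⟨y, μ⟩ * V ⟨y.shift μ, ν⟩ * (V ⟨y.shift ν, μ⟩)⁻¹ : SU N) : Matrix (Fin N) (Fin N) ℂ) * Zm ⟨y.shift ν, μ⟩ *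
          star ((V ⟨y, μ⟩ * V ⟨y.shift μ, ν⟩ * (V ⟨y.shift ν, μ⟩)⁻¹ : SU N) : Matrix (Fin N) (Fin N) ℂ) -
        ((V ⟨y, μ⟩ * V ⟨y.shift μ, ν⟩ * (V ⟨y.shift ν, μ⟩)⁻¹ * (V ⟨y, ν⟩)⁻¹ : SU N) : Matrix (Fin N) (Fin N) ℂ) * Zm ⟨y, ν⟩ *
          star ((V ⟨y, μ⟩ * V ⟨y.shift μ, ν⟩ * (V ⟨y.shift ν, μ⟩)⁻¹ * (V ⟨y, ν⟩)⁻¹ : SU N) : Matrix (Fin N) (Fin N) ℂ) := by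
    simp only [hT₃, hT₄, Matrix.mul_neg, Matrix.neg_mul]
    abel
  rw [e] at h
  exact h

end RelPlaq

/-! ## §4 The fine and the coarse specialisations -/

section Special

/-- ★★ **FINE LEVEL**: the relative plaquette of the chart point `(Θ^B(X)·U₀, U₀)` at `q = (z; μ, ν)` versus the linearised curl of `X̂` at `U₀`:
`‖↑(plaqHol (Θ(X)U₀) q · (plaqHol U₀ q)⁻¹) − 1 − Y_{U₀}(∂q)[X̂]‖ ≤ e^{4‖X‖} − 1 − 4‖X‖`. [cite: Balaban1985Averaging, (9) p.19, (19)-(20) p.21, (58) p.27] -/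
theorem norm_coe_relPlaq_fine_sub_one_sub_curl_le (U₀ : GaugeField P j (SU N)) (X : PBond P j → (specialUnitaryLogChart (Fin N)).lie) (z : Site P j)
    {μ ν : Fin P.d} (hμν : μ < ν) :
    ‖((GaugeField.plaqHol (fun b => (isChartRep_specialUnitaryGroup (n := Fin N)).expChart (X b) * U₀ b) ⟨z, μ, ν, hμν⟩ * (GaugeField.plaqHol U₀ ⟨z, μ, ν, hμν⟩)⁻¹ : SU N) :
          Matrix (Fin N) (Fin N) ℂ) - 1 -
        covWalkSum U₀ (fun b => ((X b : (specialUnitaryLogChart (Fin N)).lie) : Matrix (Fin N) (Fin N) ℂ)) (walk z [((μ, true) : Letter P.d), (ν, true), (μ, false), (ν, false)])‖ ≤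
      Real.exp (4 * ‖X‖) - 1 - 4 * ‖X‖ := by
  have h := norm_coe_relPlaq_sub_one_sub_curl_le U₀ X z hμν
  set S := ‖X ⟨z, μ⟩‖ + ‖X ⟨z.shift μ, ν⟩‖ + ‖X ⟨z.shift ν, μ⟩‖ + ‖X ⟨z, ν⟩‖ with hS
  have hS4 : S ≤ 4 * ‖X‖ := by
    have := norm_le_pi_norm X ⟨z, μ⟩; have := norm_le_pi_norm X ⟨z.shift μ, ν⟩; have := norm_le_pi_norm X ⟨z.shift ν, μ⟩; have := norm_le_pi_norm X ⟨z, ν⟩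
    linarith
  -- `t ↦ e^t − 1 − t` is monotone on `t ≥ 0`
  have hS0 : 0 ≤ S := by rw [hS]; positivity
  have hmono : Real.exp S - 1 - S ≤ Real.exp (4 * ‖X‖) - 1 - (4 * ‖X‖) := by
    have hconv : ∀ a b : ℝ, 0 ≤ a → a ≤ b → Real.exp a - 1 - a ≤ Real.exp b - 1 - b := by
      intro a b ha hab
      have h1 : Real.exp a * (b - a) ≤ Real.exp b - Real.exp a := by
        have := Real.add_one_le_exp (b - a)
        have hea : 0 < Real.exp a := Real.exp_pos a
        calc Real.exp a * (b - a) ≤ Real.exp a * (Real.exp (b - a) - 1) := by apply mul_le_mul_of_nonneg_left _ hea.le; linarith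
          _ = Real.exp b - Real.exp a := by rw [mul_sub, mul_one, ← Real.exp_add]; ring_nf
      have h2 : (b - a) ≤ Real.exp a * (b - a) := by
        have : 1 ≤ Real.exp a := Real.one_le_exp ha
        nlinarith
      linarith
    exact hconv S (4 * ‖X‖) hS0 hS4
  exact h.trans hmono

/-- ★★★ **COARSE LEVEL**: on the polydisc `100ℓ(e^{‖X‖} − 1) ≤ ρ` (`0 < ρ ≤ innerRadius`, loop guard `α` at every coarse bond, `4α ≤ ρ`) the chart-read average inverts —
`Ū(Θ(X)U₀)(c) = Θ(ψ_{U₀}(X)(c))·Ū(U₀)(c)` — and the coarse relative plaquette of `(Ū(Θ(X)U₀), Ū(U₀))` at `p′ = (y; μ, ν)` is `1 + Y_{Ū(U₀)}(∂p′)[ψ̂_{U₀}(X)]` (FILE C's left-hand side)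
up to `e^S − 1 − S`, `S = Σ_k ‖ψ_{U₀}(X)(c_k)‖ ≤ 4·(560∕ρ)·ℓ·‖X‖`. [cite: Balaban1985Averaging, (9) p.19, (19)-(20) p.21, Prop. 3 (124)-(126) p.36; Balaban1987RG1, (0.4), (0.8) p.253] -/
theorem norm_coe_relPlaq_avgFun_sub_one_sub_curl_le (U₀ : GaugeField P j (SU N)) {α ρ : ℝ} (hρ0 : 0 < ρ) (hρ : ρ ≤ innerRadius (specialUnitaryLogChart (Fin N)))
    (hα : ∀ (c : PBond P (j + 1)) (i : Idx P), dist1 (loopHol U₀ c i) ≤ α) (hα4 : 4 * α ≤ ρ) (X : PBond P j → (specialUnitaryLogChart (Fin N)).lie)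
    (hX : 100 * ((((P.d + 2) * P.L : ℕ) : ℝ) * (Real.exp ‖X‖ - 1)) ≤ ρ) (y : Site P (j + 1)) {μ ν : Fin P.d} (hμν : μ < ν) :
    ‖((GaugeField.plaqHol (avgFun (expMeanLogSU (n := Fin N)) (fun b => (isChartRep_specialUnitaryGroup (n := Fin N)).expChart (X b) * U₀ b)) ⟨y, μ, ν, hμν⟩ *
            (GaugeField.plaqHol (avgFun (expMeanLogSU (n := Fin N)) U₀) ⟨y, μ, ν, hμν⟩)⁻¹ : SU N) : Matrix (Fin N) (Fin N) ℂ) - 1 -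
        covWalkSum (avgFun (expMeanLogSU (n := Fin N)) U₀)
          (fun c : PBond P (j + 1) => (((isChartRep_specialUnitaryGroup (n := Fin N)).logChart
            (avgFun (expMeanLogSU (n := Fin N)) (fun b => (isChartRep_specialUnitaryGroup (n := Fin N)).expChart (X b) * U₀ b) c *
              (avgFun (expMeanLogSU (n := Fin N)) U₀ c)⁻¹) : (specialUnitaryLogChart (Fin N)).lie) : Matrix (Fin N) (Fin N) ℂ))
          (walk y [((μ, true) : Letter P.d), (ν, true), (μ, false), (ν, false)])‖ ≤
      Real.exp (4 * (560 / ρ * (((P.d + 2) * P.L : ℕ) : ℝ) * ‖X‖)) - 1 - 4 * (560 / ρ * (((P.d + 2) * P.L : ℕ) : ℝ) * ‖X‖) := by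
  set V := avgFun (expMeanLogSU (n := Fin N)) U₀ with hV
  set VX := avgFun (expMeanLogSU (n := Fin N)) (fun b => (isChartRep_specialUnitaryGroup (n := Fin N)).expChart (X b) * U₀ b) with hVX
  set ψ : PBond P (j + 1) → (specialUnitaryLogChart (Fin N)).lie := fun c => (isChartRep_specialUnitaryGroup (n := Fin N)).logChart (VX c * (V c)⁻¹) with hψ
  -- the chart inverts at every coarse bond: `Θ(ψ c)·V c = VX c`
  have hinv : ∀ c : PBond P (j + 1), (isChartRep_specialUnitaryGroup (n := Fin N)).expChart (ψ c) * V c = VX c := by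
    intro c
    have hsmall : ‖fundamentalRep (n := Fin N) (VX c * (V c)⁻¹) - 1‖ < innerRadius (specialUnitaryLogChart (Fin N)) := by
      rw [fundamentalRep_apply]
      have h1 := norm_coe_relAvg_sub_one_le U₀ c hρ (hα c) hα4 hρ0 X hX
      have h2 : 27 * ((((P.d + 2) * P.L : ℕ) : ℝ) * (Real.exp ‖X‖ - 1)) < ρ := by
        have h3 : 0 ≤ (((P.d + 2) * P.L : ℕ) : ℝ) * (Real.exp ‖X‖ - 1) := mul_nonneg (Nat.cast_nonneg _) (by linarith [Real.add_one_le_exp ‖X‖, norm_nonneg X])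
        nlinarith
      exact lt_of_le_of_lt h1 (lt_of_lt_of_le h2 hρ)
    rw [hψ]; dsimp only
    rw [(isChartRep_specialUnitaryGroup (n := Fin N)).expChart_logChart hsmall, inv_mul_cancel_right]
  have hfun : (fun c : PBond P (j + 1) => (isChartRep_specialUnitaryGroup (n := Fin N)).expChart (ψ c) * V c) = VX := funext hinv
  have h := norm_coe_relPlaq_sub_one_sub_curl_le V ψ y hμν
  rw [hfun] at h
  -- sizes of the four chart readings ((β-5) global edition)
  have hsz : ∀ c : PBond P (j + 1), ‖ψ c‖ ≤ 560 / ρ * (((P.d + 2) * P.L : ℕ) : ℝ) * ‖X‖ := by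
    intro c
    rw [← Submodule.norm_coe]
    exact norm_coe_chartRead_le_global U₀ hρ0 hρ hα hα4 X c
  set S := ‖ψ ⟨y, μ⟩‖ + ‖ψ ⟨y.shift μ, ν⟩‖ + ‖ψ ⟨y.shift ν, μ⟩‖ + ‖ψ ⟨y, ν⟩‖ with hS
  have hS4 : S ≤ 4 * (560 / ρ * (((P.d + 2) * P.L : ℕ) : ℝ) * ‖X‖) := by
    have := hsz ⟨y, μ⟩; have := hsz ⟨y.shift μ, ν⟩; have := hsz ⟨y.shift ν, μ⟩; have := hsz ⟨y, ν⟩; linarith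
  have hS0 : 0 ≤ S := by rw [hS]; positivity
  have hconv : ∀ a b : ℝ, 0 ≤ a → a ≤ b → Real.exp a - 1 - a ≤ Real.exp b - 1 - b := by
    intro a b ha hab
    have h1 : Real.exp a * (b - a) ≤ Real.exp b - Real.exp a := by
      have := Real.add_one_le_exp (b - a)
      have hea : 0 < Real.exp a := Real.exp_pos a
      calc Real.exp a * (b - a) ≤ Real.exp a * (Real.exp (b - a) - 1) := by apply mul_le_mul_of_nonneg_left _ hea.le; linarith
        _ = Real.exp b - Real.exp a := by rw [mul_sub, mul_one, ← Real.exp_add]; ring_nf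
    have h2 : (b - a) ≤ Real.exp a * (b - a) := by
      have : 1 ≤ Real.exp a := Real.one_le_exp ha
      nlinarith
    linarith
  exact h.trans (hconv S _ hS0 hS4)

end Special

end Summit.QuantumFields.YangMills.Theorems.FluctuationComparisonRegPrIntLS2BetaCoarseCurlJunction

end
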